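import Summits.NavierStokesRegularity.NavierStokesRegularity.Theorems.AdaptedKernelExists.Negative.UniformDriftKernel

/-!
# `AdaptedKernelExists` (stmt-NavierStokesRegularity-2956): the Type-I rate is load-bearing for the linear transfer target

Negative / support lemmas for the crux `AdaptedFrequency.AdaptedKernelExists`, extracted from the
crux work file `Cruxes/AdaptedKernelExists/Disproof.lean` (cdisprove seat, cycle 1), §3.2 and §4.
No conclusion asserts a route item.

Drop the Type-I rate from the linear transfer target `C⁺` and keep smoothness and `div b = 0`: the
uniform drift `a(t) e`, `a = (T - t)^{-3/4}` (integrable to the pole, NOT Type-I: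
`not_isTypeIBlowup_super`) has the explicit adapted kernel recentred by
`D(t) = 4(T - t)^{1/4} ≫ √(T - t)` (file `UniformDriftKernel`; written with square roots only):
adapted (`isAdaptedBackwardKernel_super`) but NOT Gaussian-comparable — the lower bound fails at the
pole (`super_not_lower`, `not_isGaussianComparable_super`). Modulo Widder-type uniqueness at the
pole (hypothesis `H` of `linear_without_rate_false_of_uniqueness`; true, unformalised) this makes
the rate-free linear claim FALSE: any proof of `C⁺` must use the rate. [folklore]
-/

noncomputable section

namespace Summit.NavierStokesRegularity.NavierStokesRegularity.Theorems.AdaptedKernelExistsNegative.SuperTypeI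

open Set Filter Topology MeasureTheory Function
open scoped Laplacian InnerProductSpace RealInnerProductSpace ContDiff
open Literature.Analysis.FluidPDE Literature.Analysis

local notation "ℝ³" => EuclideanSpace ℝ (Fin 3)

open UniformDrift


variable {ν T : ℝ} {x₀ e : ℝ³}

/-- Super-Type-I amplitude `a(t) = (T - t)^{-3/4} = 1/(√(T - t) · √√(T - t))`. -/
def superAmp (T : ℝ) (t : ℝ) : ℝ := 1 / (Real.sqrt (T - t) * Real.sqrt (Real.sqrt (T - t)))

/-- Its displacement-to-come `D(t) = ∫ₜᵀ a = 4 (T - t)^{1/4} = 4 √√(T - t)`. -/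
def superDisp (T : ℝ) (t : ℝ) : ℝ := 4 * Real.sqrt (Real.sqrt (T - t))

/-- The adapted kernel of the super-Type-I uniform drift. -/
def superKernel (ν T : ℝ) (x₀ e : ℝ³) : ℝ → ℝ³ → ℝ := recentredKernel ν T x₀ e (superDisp T)

/-- The super-Type-I displacement is smooth before `T`. [folklore] -/
theorem contDiffOn_superDisp (T : ℝ) {n : WithTop ℕ∞} : ContDiffOn ℝ n (superDisp T) (Iio T) :=
  fun _ ht => (contDiffAt_const.mul (((contDiffAt_const.sub contDiffAt_id).sqrt
    (sub_pos.2 ht).ne').sqrt (Real.sqrt_pos.2 (sub_pos.2 ht)).ne')).contDiffWithinAt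

/-- The super-Type-I amplitude is smooth before `T`. [folklore] -/
theorem contDiffOn_superAmp (T : ℝ) {n : WithTop ℕ∞} : ContDiffOn ℝ n (superAmp T) (Iio T) := by
  intro t ht
  have h1 : 0 < T - t := sub_pos.2 ht
  have h2 : 0 < Real.sqrt (T - t) := Real.sqrt_pos.2 h1
  have h3 : 0 < Real.sqrt (Real.sqrt (T - t)) := Real.sqrt_pos.2 h2
  have hs : ContDiffAt ℝ n (fun s : ℝ => Real.sqrt (T - s)) t :=
    (contDiffAt_const.sub contDiffAt_id).sqrt h1.ne'
  exact (contDiffAt_const.div (hs.mul (hs.sqrt h2.ne')) (mul_pos h2 h3).ne').contDiffWithinAt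

/-- `D' = -a` for the super-Type-I member. [folklore] -/
theorem hasDerivAt_superDisp {T t : ℝ} (ht : t < T) :
    HasDerivAt (superDisp T) (-(superAmp T t)) t := by
  have h1 : 0 < T - t := sub_pos.2 ht
  have h2 : 0 < Real.sqrt (T - t) := Real.sqrt_pos.2 h1
  have h3 : 0 < Real.sqrt (Real.sqrt (T - t)) := Real.sqrt_pos.2 h2
  have hA : HasDerivAt (fun s : ℝ => Real.sqrt (T - s)) ((0 - 1) / (2 * Real.sqrt (T - t))) t :=
    ((hasDerivAt_const t T).sub (hasDerivAt_id t)).sqrt h1.ne'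
  have hB := (hA.sqrt h2.ne').const_mul (4 : ℝ)
  refine hB.congr_deriv ?_
  simp only [superAmp]
  field_simp
  ring

/-- `D(t) → 0` as `t ↑ T` for the super-Type-I member. [folklore] -/
theorem tendsto_superDisp (T : ℝ) : Tendsto (superDisp T) (𝓝[<] T) (𝓝 0) := by
  have hc : Continuous (superDisp T) := by unfold superDisp; fun_prop
  have := hc.tendsto T
  simp only [superDisp, sub_self, Real.sqrt_zero, mul_zero] at this
  exact this.mono_left nhdsWithin_le_nhds

/-- **The super-Type-I drift carries an explicit adapted kernel** (all five clauses). -/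
theorem isAdaptedBackwardKernel_super (hν : 0 < ν) (T : ℝ) (x₀ e : ℝ³) :
    IsAdaptedBackwardKernel ν (uniformVel (superAmp T) e) (Iio T) T x₀ (superKernel ν T x₀ e) :=
  isAdaptedBackwardKernel_recentred hν T x₀ e (contDiffOn_superDisp T)
    (fun _ ht => hasDerivAt_superDisp ht) (tendsto_superDisp T)

/-- The super-Type-I drift is smooth, divergence-free and a classical NS solution on `[0, T)`. -/
theorem isClassicalNSSolutionOn_super (μ : ℝ) (T : ℝ) (e : ℝ³) :
    IsClassicalNSSolutionOn (Ico 0 T) μ 0 (uniformVel (superAmp T) e)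
      (uniformPres (derivWithin (superAmp T) (Ico 0 T)) e) :=
  isClassicalNSSolutionOn_uniform (uniqueDiffOn_Ico 0 T)
    ((contDiffOn_superAmp T).mono Ico_subset_Iio_self) μ e

/-- **It is NOT Type-I** (`e ≠ 0`): `√(T - t) ‖u(t)‖ = ‖e‖ (T - t)^{-1/4} → ∞`. -/
theorem not_isTypeIBlowup_super (he : e ≠ 0) (T : ℝ) : ¬ IsTypeIBlowup (uniformVel (superAmp T) e) T := by
  rintro ⟨C, hC⟩
  -- `C √√(T - t) → 0` as `t ↑ T`
  have hlim : Tendsto (fun t : ℝ => C * Real.sqrt (Real.sqrt (T - t))) (𝓝[<] T) (𝓝 0) := by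
    have hc : Continuous (fun t : ℝ => C * Real.sqrt (Real.sqrt (T - t))) := by fun_prop
    have := hc.tendsto T
    simp only [sub_self, Real.sqrt_zero, mul_zero] at this
    exact this.mono_left nhdsWithin_le_nhds
  have hev := hC.and ((hlim.eventually (gt_mem_nhds (norm_pos_iff.2 he))).and self_mem_nhdsWithin)
  obtain ⟨t, h1, h2, h3⟩ := hev.exists
  have ht : t < T := h3
  have hs : 0 < T - t := sub_pos.2 ht
  have hsq : 0 < Real.sqrt (T - t) := Real.sqrt_pos.2 hs
  have hsq2 : 0 < Real.sqrt (Real.sqrt (T - t)) := Real.sqrt_pos.2 hsq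
  have h4 := h1 0
  have hn : ‖uniformVel (superAmp T) e t 0‖ = ‖e‖ / (Real.sqrt (T - t) * Real.sqrt (Real.sqrt (T - t))) := by
    simp only [uniformVel_apply, superAmp, norm_smul, norm_div, norm_one, norm_mul, Real.norm_eq_abs,
      abs_of_pos hsq, abs_of_pos hsq2]
    ring
  rw [hn, div_le_div_iff₀ (mul_pos hsq hsq2) hsq] at h4
  -- h4 : ‖e‖ * √(T-t) ≤ C * (√(T-t) * √√(T-t))
  have h5 : ‖e‖ ≤ C * Real.sqrt (Real.sqrt (T - t)) := by
    have := h4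
    nlinarith [hsq, hsq2, norm_nonneg e]
  linarith

/-- **Pole value** of the super kernel: `Γ(t, x₀) = (4πν)^{-3/2} (T - t)^{-3/2} e^{-4‖e‖²/(ν√(T - t))}`. -/
theorem superKernel_pole (hν : 0 < ν) {t : ℝ} (ht : t < T) :
    superKernel ν T x₀ e t x₀ =
      (4 * Real.pi * ν) ^ (-(3 : ℝ) / 2) * (T - t) ^ (-(3 : ℝ) / 2) *
        Real.exp (-(4 * ‖e‖ ^ 2 / (ν * Real.sqrt (T - t)))) := by
  have hs : 0 < T - t := sub_pos.2 ht
  have hsq : 0 < Real.sqrt (T - t) := Real.sqrt_pos.2 hs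
  rw [superKernel, recentredKernel_closed_form hν.le x₀ e _ ht x₀, sub_self, zero_add]
  congr 2
  have hD : ‖superDisp T t • e‖ ^ 2 = 16 * Real.sqrt (T - t) * ‖e‖ ^ 2 := by
    rw [norm_smul, mul_pow, Real.norm_eq_abs, sq_abs, superDisp, mul_pow, Real.sq_sqrt hsq.le]
    ring
  rw [hD, neg_div, neg_inj, div_eq_div_iff (by positivity) (by positivity)]
  have hss : Real.sqrt (T - t) * Real.sqrt (T - t) = T - t := Real.mul_self_sqrt hs.le
  linear_combination (16 * ν * ‖e‖ ^ 2) * hss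

/-- **The lower Gaussian bound FAILS for the super kernel** (already at the pole): no `c₁ > 0`
with `c₁ (T - t)^{-3/2} ≤ Γ(t, x₀)` on any window `[t₀, T)`. -/
theorem super_not_lower (hν : 0 < ν) (he : e ≠ 0) {t₀ : ℝ} (ht₀ : t₀ < T) :
    ¬ ∃ c₁ : ℝ, 0 < c₁ ∧ ∀ t ∈ Ico t₀ T, c₁ * (T - t) ^ (-(3 : ℝ) / 2) ≤ superKernel ν T x₀ e t x₀ := by
  rintro ⟨c₁, hc₁, h⟩
  set A : ℝ := (4 * Real.pi * ν) ^ (-(3 : ℝ) / 2) with hA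
  -- the damping factor tends to `0` as `t ↑ T`
  have hlim : Tendsto (fun t : ℝ => A * Real.exp (-(4 * ‖e‖ ^ 2 / (ν * Real.sqrt (T - t)))))
      (𝓝[<] T) (𝓝 0) := by
    have he2 : 0 < 4 * ‖e‖ ^ 2 / ν := div_pos (mul_pos four_pos (pow_pos (norm_pos_iff.2 he) 2)) hν
    have h1 : Tendsto (fun t : ℝ => Real.sqrt (T - t)) (𝓝[<] T) (𝓝[>] 0) := by
      refine tendsto_nhdsWithin_iff.2 ⟨?_, ?_⟩
      · have hc : Continuous (fun t : ℝ => Real.sqrt (T - t)) := by fun_prop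
        have := hc.tendsto T
        simp only [sub_self, Real.sqrt_zero] at this
        exact this.mono_left nhdsWithin_le_nhds
      · filter_upwards [self_mem_nhdsWithin] with t ht
        exact Real.sqrt_pos.2 (sub_pos.2 ht)
    have h2 : Tendsto (fun t : ℝ => (Real.sqrt (T - t))⁻¹) (𝓝[<] T) atTop :=
      tendsto_inv_nhdsGT_zero.comp h1
    have h3 : Tendsto (fun t : ℝ => 4 * ‖e‖ ^ 2 / ν * (Real.sqrt (T - t))⁻¹) (𝓝[<] T) atTop :=
      h2.const_mul_atTop he2
    have h4 := Real.tendsto_exp_atBot.comp (tendsto_neg_atTop_atBot.comp h3)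
    have h5 := h4.const_mul A
    rw [mul_zero] at h5
    refine h5.congr fun t => ?_
    simp only [Function.comp_apply]
    congr 2
    ring
  have hev := (hlim.eventually (gt_mem_nhds hc₁)).and (Ioo_mem_nhdsLT ht₀)
  obtain ⟨t, h1, h2⟩ := hev.exists
  have hs : 0 < T - t := sub_pos.2 h2.2
  have hspow : 0 < (T - t) ^ (-(3 : ℝ) / 2) := Real.rpow_pos_of_pos hs _
  have h3 := h t ⟨h2.1.le, h2.2⟩
  rw [superKernel_pole hν h2.2] at h3
  have h4 : c₁ * (T - t) ^ (-(3 : ℝ) / 2) ≤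
      (A * Real.exp (-(4 * ‖e‖ ^ 2 / (ν * Real.sqrt (T - t))))) * (T - t) ^ (-(3 : ℝ) / 2) := by
    calc _ ≤ _ := h3
      _ = _ := by ring
  have h5 := le_of_mul_le_mul_right h4 hspow
  linarith

/-- **The super kernel is adapted but NOT Gaussian-comparable** on any window `[t₀, T)`. -/
theorem not_isGaussianComparable_super (hν : 0 < ν) (he : e ≠ 0) {t₀ : ℝ} (ht₀ : t₀ < T) :
    ¬ IsGaussianComparable (superKernel ν T x₀ e) (Ico t₀ T) T x₀ := by
  rw [isGaussianComparable_iff_fin_three]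
  rintro ⟨c₁, c₂, C₁, C₂, hc₁, -, -, -, h⟩
  refine super_not_lower (x₀ := x₀) hν he ht₀ ⟨c₁, hc₁, fun t ht => ?_⟩
  have h1 := (h t ht x₀).1
  simpa using h1


/-- A unit vector. -/
def e₁ : ℝ³ := EuclideanSpace.single 0 1

/-- `‖e₁‖ = 1`. [folklore] -/
@[simp] theorem norm_e₁ : ‖e₁‖ = 1 := by simp [e₁]

/-- `e₁ ≠ 0`. [folklore] -/
theorem e₁_ne_zero : e₁ ≠ 0 := fun h => by simpa [h] using norm_e₁

/-- **LOAD-BEARING (the rate), modulo uniqueness.** Hypothesis `H` = Widder-type uniqueness AT THE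
POLE for adapted kernels of the super-Type-I uniform drift (true: after `y = x + D(t) e` they are
positive solutions of the backward heat equation with terminal trace `δ_{x₀}`; Widder 1944, Friedman
1964 Ch. 1 — not formalised). Conclusion: the window-form linear claim WITHOUT the rate ("every
smooth divergence-free drift carries on some final window a Gaussian-comparable adapted kernel at
every pole") is FALSE — witness the super-Type-I uniform drift. [folklore] -/
theorem linear_without_rate_false_of_uniqueness
    (H : ∀ ν : ℝ, 0 < ν → ∀ (t₀ T : ℝ) (x₀ e : ℝ³) (G : ℝ → ℝ³ → ℝ), t₀ < T →
      IsAdaptedBackwardKernel ν (uniformVel (superAmp T) e) (Ico t₀ T) T x₀ G →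
      ∀ t ∈ Ico t₀ T, G t x₀ = superKernel ν T x₀ e t x₀) :
    ¬ (∀ ν : ℝ, 0 < ν → ∀ (t₁ T : ℝ), t₁ < T → ∀ b : ℝ → ℝ³ → ℝ³, IsSmoothSpaceTimeOn (Ico t₁ T) b →
        (∀ t ∈ Ico t₁ T, VectorCalculus.IsDivFree (b t)) →
        ∀ x₀ : ℝ³, ∃ t₀ ∈ Ico t₁ T, ∃ G : ℝ → ℝ³ → ℝ,
          IsAdaptedBackwardKernel ν b (Ico t₀ T) T x₀ G ∧ IsGaussianComparable G (Ico t₀ T) T x₀) := by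
  intro h
  have hcl := isClassicalNSSolutionOn_super 1 1 e₁
  obtain ⟨t₀, ht₀, G, hK, hG⟩ :=
    h 1 one_pos 0 1 one_pos (uniformVel (superAmp 1) e₁) hcl.smooth_velocity hcl.divFree 0
  obtain ⟨c₁, c₂, C₁, C₂, hc₁, -, -, -, hb⟩ := isGaussianComparable_iff_fin_three.1 hG
  refine super_not_lower (ν := 1) (T := 1) (x₀ := 0) (e := e₁) one_pos e₁_ne_zero ht₀.2
    ⟨c₁, hc₁, fun t ht => ?_⟩
  have h1 := (hb t ht 0).1
  rw [H 1 one_pos t₀ 1 0 e₁ G ht₀.2 hK t ht] at h1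
  simpa using h1

end Summit.NavierStokesRegularity.NavierStokesRegularity.Theorems.AdaptedKernelExistsNegative.SuperTypeI

end
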